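import Summits.QuantumFields.YangMills.Theorems.UnitScaleTiltProp7OmegaOneAxialHolderMember
import Summits.QuantumFields.YangMills.Theorems.UnitScaleTiltProp7MassiveDivergenceSupClosed
import Summits.QuantumFields.YangMills.Theorems.UnitScaleTiltProp7TJSlotCoerciveClosedAllMembers
import Summits.QuantumFields.YangMills.Theorems.UnitScaleTiltProp7SectET3RealityPInvJTermT3
import HarnessLib

/-!
# Route `UnitScaleTilt`, crux K1 «MinimiserStabilityRegPr» (stmt-QuantumFields-19200), EX row (6) `norm_H₁` ∕ STOREY H letter `h3` — **(F) THE `hHωw` FAMILY: THE WINDOWED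
# COVER-AXIAL ½-HÖLDER LETTER OF `ω₁ A` FOR EVERY MEMBER OF EVERY FAMILY, `αw`, `CHω` ∃-PACKAGED (L-ONLY)** (chair ★p1 g29 WORD №68 (b); ★★OWNER g38 №149∕№155; the `hHωwRow`
# display of ✓p781801 `Prop7StoreyHGradientFamily.h3_family_exists` (S52) INHABITED).

WHAT IS PROVED (ns `Summit.QuantumFields.YangMills.Theorems.Prop7OmegaOneAxialHolderFamily`):
* ★★★ `hHωw_family_exists [hFL hFη] (c₀ cB) [hc₀ hcB] {a₀ a₁} (ha₀ ha₀₁) : ∃ (αw CHω : ℕ → ℝ), (0 < αw) ∧ (10¹²L³αw ≤ 1) ∧ (10¹⁰L⁶αw ≤ 1) ∧ (13·10¹⁴L³αw ≤ 1) ∧ (αw ≤ 1) ∧ (0 ≤ CHω) ∧ ⟨hHωwRow⟩`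
  — the `hHωwRow` binder text of ✓`h3_family_exists` VERBATIM (ws-sha16 5542d87f8ac23908): for every `L > 1`, `i : Idx L`, `RegPr ρ U₀` with `ρ ≤ αw L`, the face's Lift antecedent,
  every `a` in the window `[a₀·(c₀∕cB)·ℓ³, a₁·(c₀∕cB)·ℓ³]`, every `A`, the windowed cover-axial ½-Hölder letter of `ω₁ A = R_S(D*_{U₀}(G_{Δ₁ᴾ}(toL2 A)))` with constant `CHω L·‖A‖`.
  PROOF: (M) ✓`Prop7OmegaOneAxialHolderMember.hax_omega_one_member_of_lift` per member at `am := 1`, `ε₀ := αw L` (✓`regPr_mono`), `Δx := DeltaOneP … a (TJSlotP … a)`: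
  `hp` ⟸ ✓`hco_DeltaOnePJ_exists_allMembers` (.2.1), `hΔs` ⟸ ✓`DeltaOneP_isSymmetric` ∘ ✓`TJP_rows_at_regPr` (.2.2), `hΔ` ⟸ ✓`DeltaOneP_kills_NS`; `Ch θ₀ hHlocV` ⟸ ✓`exists_hHlocV`
  (px19∕px5), `Cw θw hWsup` ⟸ ✓`exists_hWsup` (px19 g16); the cap `αw := min (alphaH) (αc) (θ₀∕48) (θw) (10¹⁰L⁶)⁻¹ (13·10¹⁴L³)⁻¹` (✓`alphaH_windows`∕`alphaH_window_member` give `10¹²ℓ³αw ≤ 1`,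
  `αw ≤ 1`, `hsmall`); `CHω` by unification (rows first, sign second by `positivity`), `clear_value αw` (✓p781801 pattern).

HONEST BLOCK.  Assembly only over (M) and the named closed families; no `sorry`, default axioms; decl-local `maxHeartbeats 400000` (the member constant is ~7 kchar; README rule, disclosed).
With this file the `hHωwRow` display of S52∕S53∕S54 is a theorem; EX∕19200 remain open modulo `hThm2S`-class letters (not this seat's).  Rung R3 = SU(2) YM₃ on T³ — NOT d = 4, NOT infinite
volume, NOT a mass gap, NOT Clay.
[cite: Balaban1985BackgroundPropagators, Thm 3.1 (3.42)–(3.46) pp.397–398, (3.20)–(3.25) p.394, (3.49) p.399, (3.127)–(3.128) p.421, (3.151)–(3.152) pp.425–426; Balaban1984PropagatorsII, (1.9) p.226;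
Balaban1985Variational, (110) p.294, (138)–(139) p.299]
-/

set_option autoImplicit false

noncomputable section

open scoped BigOperators Matrix.Norms.L2Operator InnerProductSpace ComplexConjugate Matrix

namespace Summit.QuantumFields.YangMills.Theorems.Prop7OmegaOneAxialHolderFamily

open Literature.MathematicalPhysics.QuantumFieldTheory.Balaban1983to89
open Literature.MathematicalPhysics.QuantumFieldTheory.Balaban1983to89.T3ContinuumYM3Torus
open Literature.MathematicalPhysics.QuantumFieldTheory.Balaban1983to89.T3Thm1Carrier (Idx)
open Literature.MathematicalPhysics.QuantumFieldTheory.Balaban1983to89.T3PrintedMinimiserExistence (regPr_mono)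
open T4Continuum
open B15DeterminingSets (embIter)
open B10Eq27TorusAxialLog (axialT)
open B4Sect5Torus (TSite tdist)
open B9Eq311L2Pairing (WL2)
open Summit.QuantumFields.YangMills.Theorems.Prop8Chart (emlIterU)
open T3SectALandauChart (bgUnits)
open T3PrintedRegularMinimiser (RegPr)
open Summit.QuantumFields.YangMills.Theorems.Prop7SectET3Transport (periodsT3 siteEquiv)
open Summit.QuantumFields.YangMills.Theorems.Prop7SectET3HilbertLetters (W₂ toL2 toL2S DL2 DstarL2)
open Summit.QuantumFields.YangMills.Theorems.Prop7SectET3GaugeProjector (NS RS)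
open Summit.QuantumFields.YangMills.Theorems.Prop7SectET3CurvedPropagators (PosOnto GT)
open Summit.QuantumFields.YangMills.Theorems.Prop7SectET3DeltaOnePInv (DeltaOneP TJSlotP DeltaOneP_kills_NS)
open Summit.QuantumFields.YangMills.Theorems.Prop7SectET3RealityPInvOne (DeltaOneP_isSymmetric)
open Summit.QuantumFields.YangMills.Theorems.Prop7SectET3RealityPInvJTerm (TJP_rows_at_regPr)
open Summit.QuantumFields.YangMills.Theorems.Prop7TJSlotCoerciveClosedAllMembers (hco_DeltaOnePJ_exists_allMembers)
open Summit.QuantumFields.YangMills.Theorems.Prop7CurvedMemberLocalGradient (exists_curved_localGradient)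
open Summit.QuantumFields.YangMills.Theorems.AxialGaugeChartGlue (norm_bgOfCfg_axialT_sub_le)
open Summit.QuantumFields.YangMills.Theorems.Prop7ChainPotentialHessianFamily (alphaH_pos alphaH_windows alphaH_window_member)
open Summit.QuantumFields.YangMills.Theorems.Prop7CurvedMemberLocalHolder (exists_hHlocV)
open Summit.QuantumFields.YangMills.Theorems.Prop7MassiveDivergenceSupClosed (exists_hWsup)
open Summit.QuantumFields.YangMills.Theorems.Prop7OmegaOneAxialHolderMember (hax_omega_one_member_of_lift)
open Summit.QuantumFields.YangMills.Theorems.CoverSites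

-- HEARTBEAT rule (README): the member constant (~7 kchar) is unified into `CHω` once per member application; decl-local 400000, disclosed.
set_option maxHeartbeats 400000 in
/-- ★★★ **THE `hHωw` FAMILY — H8-R′ v2's windowed Hölder letter for every member of every family, `αw`, `CHω` L-ONLY, ∃-PACKAGED** ((M) per member at `am := 1`, `ε₀ := αw L`;
slot class from ✓`hco_DeltaOnePJ_exists_allMembers`, ✓`TJP_rows_at_regPr`, ✓`DeltaOneP_isSymmetric`, ✓`DeltaOneP_kills_NS`; local letters from ✓`exists_hHlocV`, ✓`exists_hWsup`).
Conjuncts: `0 < αw`, `10¹²L³αw ≤ 1`, `10¹⁰L⁶αw ≤ 1`, `13·10¹⁴L³αw ≤ 1`, `αw ≤ 1`, `0 ≤ CHω`, then the `hHωwRow` text of ✓`h3_family_exists` verbatim.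
[cite: Balaban1985BackgroundPropagators, Thm 3.1 (3.42)–(3.46) pp.397–398, (3.49) p.399, (3.127)–(3.128) p.421; Balaban1985Variational, (110) p.294, (138)–(139) p.299] -/
theorem hHωw_family_exists [hFL : ∀ F : T3Family, Fact (0 < (F.L : ℝ))] [hFη : ∀ (F : T3Family) (k : ℕ), Fact (0 < ((F.L : ℝ)⁻¹) ^ k)]
    (c₀ cB : ℕ → ℝ) [hc₀ : ∀ L : ℕ, Fact (0 < c₀ L)] [hcB : ∀ L : ℕ, Fact (0 < cB L)] {a₀ a₁ : ℝ} (ha₀ : 0 < a₀) (ha₀₁ : a₀ ≤ a₁) :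
    ∃ (αw CHω : ℕ → ℝ), (∀ L : ℕ, 1 < L → 0 < αw L) ∧ (∀ L : ℕ, 1 < L → 10 ^ 12 * (L : ℝ) ^ 3 * αw L ≤ 1) ∧ (∀ L : ℕ, 1 < L → 10 ^ 10 * (L : ℝ) ^ 6 * αw L ≤ 1) ∧
      (∀ L : ℕ, 1 < L → 13 * 10 ^ 14 * (L : ℝ) ^ 3 * αw L ≤ 1) ∧ (∀ L : ℕ, 1 < L → αw L ≤ 1) ∧ (∀ L : ℕ, 1 < L → 0 ≤ CHω L) ∧
    ∀ (L : ℕ), 1 < L → ∀ (i : Idx L) (U₀ : GaugeField (i.1.1.P i.1.2.2) 0 (Matrix.specialUnitaryGroup (Fin 2) ℂ)), ∀ ρ : ℝ, RegPr i.1.1 i.1.2.1 i.1.2.2 ρ U₀ → ρ ≤ αw L →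
        (∀ cf : Site (i.1.1.P i.1.2.2) (i.1.2.2 - i.1.2.1) → Matrix (Fin 2) (Fin 2) ℂ,
        (∀ e' : PBond (i.1.1.P i.1.2.2) (i.1.2.2 - i.1.2.1), cf e'.src = ((emlIterU (i.1.2.2 - i.1.2.1) (bgUnits i.1.1 i.1.2.2 U₀) e' : (Matrix (Fin 2) (Fin 2) ℂ)ˣ) : Matrix (Fin 2) (Fin 2) ℂ) * cf e'.tgt *
        (((emlIterU (i.1.2.2 - i.1.2.1) (bgUnits i.1.1 i.1.2.2 U₀) e')⁻¹ : (Matrix (Fin 2) (Fin 2) ℂ)ˣ) : Matrix (Fin 2) (Fin 2) ℂ)) →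
        ∃ l₀ : Site (i.1.1.P i.1.2.2) 0 → Matrix (Fin 2) (Fin 2) ℂ,
        (∀ b' : PBond (i.1.1.P i.1.2.2) 0, l₀ b'.src = ((bgUnits i.1.1 i.1.2.2 U₀ b' : (Matrix (Fin 2) (Fin 2) ℂ)ˣ) : Matrix (Fin 2) (Fin 2) ℂ) * l₀ b'.tgt * (((bgUnits i.1.1 i.1.2.2 U₀ b')⁻¹ : (Matrix (Fin 2) (Fin 2) ℂ)ˣ) : Matrix (Fin 2) (Fin 2) ℂ)) ∧
        ∀ y : Site (i.1.1.P i.1.2.2) (i.1.2.2 - i.1.2.1), l₀ (embIter (i.1.2.2 - i.1.2.1) y) = cf y) →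
      ∀ a : ℝ, a₀ * (c₀ L / cB L) * ((i.1.1.L : ℝ) ^ (i.1.2.2 - i.1.2.1)) ^ 3 ≤ a → a ≤ a₁ * (c₀ L / cB L) * ((i.1.1.L : ℝ) ^ (i.1.2.2 - i.1.2.1)) ^ 3 →
      ∀ (A : PBond (i.1.1.P i.1.2.2) 0 → Matrix (Fin 2) (Fin 2) ℂ) (ct : Site ((i.1.1.cover 3).P i.1.2.2) 0) (yt yt' : TSite 3 (periodsT3 (i.1.1.cover 3) i.1.2.2)),
      tdist (periodsT3 (i.1.1.cover 3) i.1.2.2) (siteEquiv (i.1.1.cover 3) i.1.2.2 ct) yt ≤ 4 * (i.1.1.L : ℝ) ^ (i.1.2.2 - i.1.2.1) + 1 →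
      tdist (periodsT3 (i.1.1.cover 3) i.1.2.2) (siteEquiv (i.1.1.cover 3) i.1.2.2 ct) yt' ≤ 4 * (i.1.1.L : ℝ) ^ (i.1.2.2 - i.1.2.1) + 1 →
      tdist (periodsT3 (i.1.1.cover 3) i.1.2.2) yt yt' ≤ (i.1.1.L : ℝ) ^ (i.1.2.2 - i.1.2.1) →
      ‖WL2.equiv ℂ (fun _ : TSite 3 (periodsT3 (i.1.1.cover 3) i.1.2.2) => c₀ L) W₂
            (toL2S (i.1.1.cover 3) i.1.2.2 (c₀ L) (fun zt => ((axialT (U₀ ∘ projBond (i.1.1.P i.1.2.2) 3 0) ct zt : Matrix.specialUnitaryGroup (Fin 2) ℂ) : Matrix (Fin 2) (Fin 2) ℂ)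
              * (toL2S i.1.1 i.1.2.2 (c₀ L)).symm (RS i.1.1 i.1.2.1 i.1.2.2 i.2.2.le (c₀ L) (cB L) U₀ (DstarL2 i.1.1 i.1.2.1 i.1.2.2 (c₀ L) U₀ (GT i.1.1 i.1.2.1 i.1.2.2 i.2.2.le (c₀ L) (cB L) a (DeltaOneP i.1.1 i.1.2.1 i.1.2.2 i.2.2.le (c₀ L) (cB L) a (TJSlotP i.1.1 i.1.2.1 i.1.2.2 i.2.2.le (c₀ L) (cB L) a)) U₀ (toL2 i.1.1 i.1.2.2 (c₀ L) A)))) (proj (i.1.1.P i.1.2.2) 3 0 zt)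
              * star ((axialT (U₀ ∘ projBond (i.1.1.P i.1.2.2) 3 0) ct zt : Matrix.specialUnitaryGroup (Fin 2) ℂ) : Matrix (Fin 2) (Fin 2) ℂ))) yt'
          - WL2.equiv ℂ (fun _ : TSite 3 (periodsT3 (i.1.1.cover 3) i.1.2.2) => c₀ L) W₂
            (toL2S (i.1.1.cover 3) i.1.2.2 (c₀ L) (fun zt => ((axialT (U₀ ∘ projBond (i.1.1.P i.1.2.2) 3 0) ct zt : Matrix.specialUnitaryGroup (Fin 2) ℂ) : Matrix (Fin 2) (Fin 2) ℂ)
              * (toL2S i.1.1 i.1.2.2 (c₀ L)).symm (RS i.1.1 i.1.2.1 i.1.2.2 i.2.2.le (c₀ L) (cB L) U₀ (DstarL2 i.1.1 i.1.2.1 i.1.2.2 (c₀ L) U₀ (GT i.1.1 i.1.2.1 i.1.2.2 i.2.2.le (c₀ L) (cB L) a (DeltaOneP i.1.1 i.1.2.1 i.1.2.2 i.2.2.le (c₀ L) (cB L) a (TJSlotP i.1.1 i.1.2.1 i.1.2.2 i.2.2.le (c₀ L) (cB L) a)) U₀ (toL2 i.1.1 i.1.2.2 (c₀ L) A)))) (proj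 (i.1.1.P i.1.2.2) 3 0 zt)
              * star ((axialT (U₀ ∘ projBond (i.1.1.P i.1.2.2) 3 0) ct zt : Matrix.specialUnitaryGroup (Fin 2) ℂ) : Matrix (Fin 2) (Fin 2) ℂ))) yt‖
        ≤ (CHω L * ‖A‖) * (tdist (periodsT3 (i.1.1.cover 3) i.1.2.2) yt yt' / ((i.1.1.L : ℝ) ^ (i.1.2.2 - i.1.2.1))) ^ ((1 : ℝ) / 2) := by
  -- the closed families and the two ∃-closed local letters (L-free constants)
  obtain ⟨αc, γc, hαc, -, -, -, hco⟩ := hco_DeltaOnePJ_exists_allMembers c₀ cB ha₀ ha₀₁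
  obtain ⟨Ch, θ₀, hCh, hθ₀, hHlocV⟩ := exists_hHlocV
  obtain ⟨Cw, θw, hCw, hθw, hWsup⟩ := exists_hWsup
  have hCg : 0 ≤ exists_curved_localGradient.choose := exists_curved_localGradient.choose_spec.1
  have hCax : 0 ≤ norm_bgOfCfg_axialT_sub_le.choose := norm_bgOfCfg_axialT_sub_le.choose_spec.1
  -- the cap
  set αw : ℕ → ℝ := fun L => min (min (min (min (1 / (10 ^ 12 * (L : ℝ) ^ 3)) (1 / (2 * ((exists_curved_localGradient.choose + 1) * (48 * (6 * Real.sqrt 2 * Real.sqrt 10 + 6 * Real.sqrt 2)))))) (αc L))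
    (min (θ₀ / 48) θw)) (min (1 / (10 ^ 10 * (L : ℝ) ^ 6)) (1 / (13 * 10 ^ 14 * (L : ℝ) ^ 3))) with hαw
  have hαw0 : ∀ L : ℕ, 1 < L → 0 < αw L := fun L hL => by
    have := hαc L hL; have := alphaH_pos L hL
    have hL0 : (0 : ℝ) < L := by exact_mod_cast (by omega : 0 < L)
    simp only [hαw]
    exact lt_min (lt_min (lt_min ‹_› ‹_›) (lt_min (by positivity) hθw)) (lt_min (by positivity) (by positivity))
  have hαH' : ∀ L, αw L ≤ min (1 / (10 ^ 12 * (L : ℝ) ^ 3)) (1 / (2 * ((exists_curved_localGradient.choose + 1) * (48 * (6 * Real.sqrt 2 * Real.sqrt 10 + 6 * Real.sqrt 2))))) := fun L => by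
    simp only [hαw]; exact (min_le_left _ _).trans ((min_le_left _ _).trans (min_le_left _ _))
  have hαc' : ∀ L, αw L ≤ αc L := fun L => by simp only [hαw]; exact (min_le_left _ _).trans ((min_le_left _ _).trans (min_le_right _ _))
  have hαθ : ∀ L, αw L ≤ θ₀ / 48 := fun L => by simp only [hαw]; exact (min_le_left _ _).trans ((min_le_right _ _).trans (min_le_left _ _))
  have hαθw : ∀ L, αw L ≤ θw := fun L => by simp only [hαw]; exact (min_le_left _ _).trans ((min_le_right _ _).trans (min_le_right _ _))
  have hα10 : ∀ L, αw L ≤ 1 / (10 ^ 10 * (L : ℝ) ^ 6) := fun L => by simp only [hαw]; exact (min_le_right _ _).trans (min_le_left _ _)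
  have hα13 : ∀ L, αw L ≤ 1 / (13 * 10 ^ 14 * (L : ℝ) ^ 3) := fun L => by simp only [hαw]; exact (min_le_right _ _).trans (min_le_right _ _)
  -- the cap is used only through the inequalities above: make it opaque
  clear_value αw
  clear hαw
  have hw12 : ∀ L : ℕ, 1 < L → 10 ^ 12 * (L : ℝ) ^ 3 * αw L ≤ 1 := fun L hL => (alphaH_windows L hL (hαH' L)).1
  have hα1 : ∀ L : ℕ, 1 < L → αw L ≤ 1 := fun L hL => (alphaH_windows L hL (hαH' L)).2.1
  have hsmall : ∀ L : ℕ, 1 < L → exists_curved_localGradient.choose * ((48 * αw L) * (6 * Real.sqrt 2 * Real.sqrt 10 + 6 * Real.sqrt 2)) ≤ 1 / 2 :=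
    fun L hL => (alphaH_windows L hL (hαH' L)).2.2
  have hw12m : ∀ L : ℕ, 1 < L → ∀ i : Idx L, 10 ^ 12 * (i.1.1.L : ℝ) ^ 3 * αw L ≤ 1 := fun L hL i => alphaH_window_member L hL i (hαH' L)
  have hw10 : ∀ L : ℕ, 1 < L → 10 ^ 10 * (L : ℝ) ^ 6 * αw L ≤ 1 := fun L hL => by
    have hL0 : (0 : ℝ) < L := by exact_mod_cast (by omega : 0 < L)
    calc 10 ^ 10 * (L : ℝ) ^ 6 * αw L ≤ 10 ^ 10 * (L : ℝ) ^ 6 * (1 / (10 ^ 10 * (L : ℝ) ^ 6)) := mul_le_mul_of_nonneg_left (hα10 L) (by positivity)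
      _ = 1 := by field_simp
  have hw13 : ∀ L : ℕ, 1 < L → 13 * 10 ^ 14 * (L : ℝ) ^ 3 * αw L ≤ 1 := fun L hL => by
    have hL0 : (0 : ℝ) < L := by exact_mod_cast (by omega : 0 < L)
    calc 13 * 10 ^ 14 * (L : ℝ) ^ 3 * αw L ≤ 13 * 10 ^ 14 * (L : ℝ) ^ 3 * (1 / (13 * 10 ^ 14 * (L : ℝ) ^ 3)) := mul_le_mul_of_nonneg_left (hα13 L) (by positivity)
      _ = 1 := by field_simp
  have hθ : ∀ L, 48 * αw L ≤ θ₀ := fun L => by have := hαθ L; linarith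
  -- the lower end of the `a`-window is non-negative, and the symmetry row of the slot at every member
  have hlow : ∀ (L : ℕ) (i : Idx L), 0 ≤ a₀ * (c₀ L / cB L) * ((i.1.1.L : ℝ) ^ (i.1.2.2 - i.1.2.1)) ^ 3 := fun L i => by
    have := (hc₀ L).out; have := (hcB L).out; positivity
  have hΔs : ∀ (L : ℕ), 1 < L → ∀ (i : Idx L) (U₀ : GaugeField (i.1.1.P i.1.2.2) 0 (Matrix.specialUnitaryGroup (Fin 2) ℂ)) (ρ : ℝ),
      RegPr i.1.1 i.1.2.1 i.1.2.2 ρ U₀ → ρ ≤ αw L → ∀ a : ℝ, 0 ≤ a →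
      (DeltaOneP i.1.1 i.1.2.1 i.1.2.2 i.2.2.le (c₀ L) (cB L) a (TJSlotP i.1.1 i.1.2.1 i.1.2.2 i.2.2.le (c₀ L) (cB L) a) U₀).IsSymmetric := by
    intro L hL i U₀ ρ hreg hρ a ha
    have hL1 : (1 : ℝ) < (i.1.1.L : ℝ) := by exact_mod_cast i.1.1.hL.2
    haveI : Fact (0 < (i.1.1.L : ℝ)) := ⟨lt_trans zero_lt_one hL1⟩
    haveI : Fact (0 < ((i.1.1.L : ℝ)⁻¹) ^ (i.1.2.2 - i.1.2.1)) := ⟨pow_pos (inv_pos.2 (lt_trans zero_lt_one hL1)) _⟩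
    have he : (0 : ℝ) < (10 ^ 9 * (i.1.1.L : ℝ) ^ 2)⁻¹ := by positivity
    have hWe : 10 ^ 9 * (i.1.1.L : ℝ) ^ 2 * (10 ^ 9 * (i.1.1.L : ℝ) ^ 2)⁻¹ ≤ 1 := by rw [mul_inv_cancel₀ (by positivity)]
    have hTsymm : (TJSlotP i.1.1 i.1.2.1 i.1.2.2 i.2.2.le (c₀ L) (cB L) a U₀).IsSymmetric :=
      (TJP_rows_at_regPr i.1.1 i.1.2.1 i.1.2.2 i.2.2.le (c₀ L) (cB L) a U₀ ha (hαw0 L hL) he hWe (hw12m L hL i) (regPr_mono i.1.1 hρ hreg)).2.2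
    exact DeltaOneP_isSymmetric i.1.1 i.1.2.1 i.1.2.2 i.2.2.le (c₀ L) (cB L) a (TJSlotP i.1.1 i.1.2.1 i.1.2.2 i.2.2.le (c₀ L) (cB L) a) U₀ hTsymm
  have hm0 : (0 : ℝ) < max 2 (16 / (1 : ℝ)) := lt_of_lt_of_le two_pos (le_max_left _ _)
  -- rows FIRST (the proof assembles `CHω` by unification), sign SECOND
  have key : ∃ CHω : ℕ → ℝ, (∀ (L : ℕ), 1 < L → ∀ (i : Idx L) (U₀ : GaugeField (i.1.1.P i.1.2.2) 0 (Matrix.specialUnitaryGroup (Fin 2) ℂ)), ∀ ρ : ℝ, RegPr i.1.1 i.1.2.1 i.1.2.2 ρ U₀ → ρ ≤ αw L →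
          (∀ cf : Site (i.1.1.P i.1.2.2) (i.1.2.2 - i.1.2.1) → Matrix (Fin 2) (Fin 2) ℂ,
          (∀ e' : PBond (i.1.1.P i.1.2.2) (i.1.2.2 - i.1.2.1), cf e'.src = ((emlIterU (i.1.2.2 - i.1.2.1) (bgUnits i.1.1 i.1.2.2 U₀) e' : (Matrix (Fin 2) (Fin 2) ℂ)ˣ) : Matrix (Fin 2) (Fin 2) ℂ) * cf e'.tgt *
          (((emlIterU (i.1.2.2 - i.1.2.1) (bgUnits i.1.1 i.1.2.2 U₀) e')⁻¹ : (Matrix (Fin 2) (Fin 2) ℂ)ˣ) : Matrix (Fin 2) (Fin 2) ℂ)) →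
          ∃ l₀ : Site (i.1.1.P i.1.2.2) 0 → Matrix (Fin 2) (Fin 2) ℂ,
          (∀ b' : PBond (i.1.1.P i.1.2.2) 0, l₀ b'.src = ((bgUnits i.1.1 i.1.2.2 U₀ b' : (Matrix (Fin 2) (Fin 2) ℂ)ˣ) : Matrix (Fin 2) (Fin 2) ℂ) * l₀ b'.tgt * (((bgUnits i.1.1 i.1.2.2 U₀ b')⁻¹ : (Matrix (Fin 2) (Fin 2) ℂ)ˣ) : Matrix (Fin 2) (Fin 2) ℂ)) ∧
          ∀ y : Site (i.1.1.P i.1.2.2) (i.1.2.2 - i.1.2.1), l₀ (embIter (i.1.2.2 - i.1.2.1) y) = cf y) →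
        ∀ a : ℝ, a₀ * (c₀ L / cB L) * ((i.1.1.L : ℝ) ^ (i.1.2.2 - i.1.2.1)) ^ 3 ≤ a → a ≤ a₁ * (c₀ L / cB L) * ((i.1.1.L : ℝ) ^ (i.1.2.2 - i.1.2.1)) ^ 3 →
        ∀ (A : PBond (i.1.1.P i.1.2.2) 0 → Matrix (Fin 2) (Fin 2) ℂ) (ct : Site ((i.1.1.cover 3).P i.1.2.2) 0) (yt yt' : TSite 3 (periodsT3 (i.1.1.cover 3) i.1.2.2)),
        tdist (periodsT3 (i.1.1.cover 3) i.1.2.2) (siteEquiv (i.1.1.cover 3) i.1.2.2 ct) yt ≤ 4 * (i.1.1.L : ℝ) ^ (i.1.2.2 - i.1.2.1) + 1 →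
        tdist (periodsT3 (i.1.1.cover 3) i.1.2.2) (siteEquiv (i.1.1.cover 3) i.1.2.2 ct) yt' ≤ 4 * (i.1.1.L : ℝ) ^ (i.1.2.2 - i.1.2.1) + 1 →
        tdist (periodsT3 (i.1.1.cover 3) i.1.2.2) yt yt' ≤ (i.1.1.L : ℝ) ^ (i.1.2.2 - i.1.2.1) →
        ‖WL2.equiv ℂ (fun _ : TSite 3 (periodsT3 (i.1.1.cover 3) i.1.2.2) => c₀ L) W₂
              (toL2S (i.1.1.cover 3) i.1.2.2 (c₀ L) (fun zt => ((axialT (U₀ ∘ projBond (i.1.1.P i.1.2.2) 3 0) ct zt : Matrix.specialUnitaryGroup (Fin 2) ℂ) : Matrix (Fin 2) (Fin 2) ℂ)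
                * (toL2S i.1.1 i.1.2.2 (c₀ L)).symm (RS i.1.1 i.1.2.1 i.1.2.2 i.2.2.le (c₀ L) (cB L) U₀ (DstarL2 i.1.1 i.1.2.1 i.1.2.2 (c₀ L) U₀ (GT i.1.1 i.1.2.1 i.1.2.2 i.2.2.le (c₀ L) (cB L) a (DeltaOneP i.1.1 i.1.2.1 i.1.2.2 i.2.2.le (c₀ L) (cB L) a (TJSlotP i.1.1 i.1.2.1 i.1.2.2 i.2.2.le (c₀ L) (cB L) a)) U₀ (toL2 i.1.1 i.1.2.2 (c₀ L) A)))) (proj (i.1.1.P i.1.2.2) 3 0 zt)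
                * star ((axialT (U₀ ∘ projBond (i.1.1.P i.1.2.2) 3 0) ct zt : Matrix.specialUnitaryGroup (Fin 2) ℂ) : Matrix (Fin 2) (Fin 2) ℂ))) yt'
            - WL2.equiv ℂ (fun _ : TSite 3 (periodsT3 (i.1.1.cover 3) i.1.2.2) => c₀ L) W₂
              (toL2S (i.1.1.cover 3) i.1.2.2 (c₀ L) (fun zt => ((axialT (U₀ ∘ projBond (i.1.1.P i.1.2.2) 3 0) ct zt : Matrix.specialUnitaryGroup (Fin 2) ℂ) : Matrix (Fin 2) (Fin 2) ℂ)
                * (toL2S i.1.1 i.1.2.2 (c₀ L)).symm (RS i.1.1 i.1.2.1 i.1.2.2 i.2.2.le (c₀ L) (cB L) U₀ (DstarL2 i.1.1 i.1.2.1 i.1.2.2 (c₀ L) U₀ (GT i.1.1 i.1.2.1 i.1.2.2 i.2.2.le (c₀ L) (cB L) a (DeltaOneP i.1.1 i.1.2.1 i.1.2.2 i.2.2.le (c₀ L) (cB L) a (TJSlotP i.1.1 i.1.2.1 i.1.2.2 i.2.2.le (c₀ L) (cB L) a)) U₀ (toL2 i.1.1 i.1.2.2 (c₀ L) A)))) (proj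 (i.1.1.P i.1.2.2) 3 0 zt)
                * star ((axialT (U₀ ∘ projBond (i.1.1.P i.1.2.2) 3 0) ct zt : Matrix.specialUnitaryGroup (Fin 2) ℂ) : Matrix (Fin 2) (Fin 2) ℂ))) yt‖
          ≤ (CHω L * ‖A‖) * (tdist (periodsT3 (i.1.1.cover 3) i.1.2.2) yt yt' / ((i.1.1.L : ℝ) ^ (i.1.2.2 - i.1.2.1))) ^ ((1 : ℝ) / 2)) ∧ (∀ L : ℕ, 1 < L → 0 ≤ CHω L) :=
    ⟨_, fun L hL i U₀ ρ hreg hρ hLift a ha₀a ha₁a =>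
      hax_omega_one_member_of_lift i.1.1 i.2.2.le (c₀ := c₀ L) (cB := cB L) (hαw0 L hL) U₀ (regPr_mono i.1.1 hρ hreg) i.2.2 (hw12m L hL i) one_pos hLift
        (hco L hL i U₀ ρ hreg (hρ.trans (hαc' L)) hLift a ha₀a ha₁a).2.1
        (hΔs L hL i U₀ ρ hreg hρ a ((hlow L i).trans ha₀a))
        (DeltaOneP_kills_NS (TJSlotP i.1.1 i.1.2.1 i.1.2.2 i.2.2.le (c₀ L) (cB L) a) ((hlow L i).trans ha₀a))
        hCh (hθ L) hHlocV hCw (hαθw L) hWsup (hsmall L hL),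
      fun L hL => by
        have := hαw0 L hL
        positivity⟩
  obtain ⟨CHω, hrows, h0⟩ := key
  exact ⟨αw, CHω, hαw0, hw12, hw10, hw13, hα1, h0, hrows⟩

end Summit.QuantumFields.YangMills.Theorems.Prop7OmegaOneAxialHolderFamily

end
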